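import Summits.HubbardSuperconductivity.HubbardSuperconductivity.Theorems.KLProgrammeKLRegimeScaleZeroTwoLegTail3
import Summits.HubbardSuperconductivity.HubbardSuperconductivity.Theorems.KLProgrammeKLRegimeScaleZeroTwoLegTail3OnSite
import Summits.HubbardSuperconductivity.HubbardSuperconductivity.Theorems.KLProgrammeKLRegimeScaleZeroWeightedSizesNumeral

/-!
# Route `KLProgramme`, ENGINE child (stmt-HubbardSuperconductivity-20437), stub (C) at `n = 0`, located brick «A-SIZES-WEIGHTED» (pen (R181)) — CONSUMER FORM:
# the OFF-SITE MOMENT ROWS of the order-≥3 tail `T₃` at the bare frame with the NUMERAL size `a = 10⁹⁵` plugged in (`λ = 1`, `k ≤ 4`)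

Cell gate-hubbard-kl, seat p1 g21.  p1 g18's `twoLeg_offDiag_moment_pow_sum_tail3_frameZero_le` (…ScaleZeroTwoLegTail3) asks for the weighted row/column sizes `hrow/hcol`
of `S_{4M}ᵀC⁰_{>e₀}S_{4M}` and the smallness `16e⁹·46·a·|U| ≤ 1/2`; brick 4f(ii) (`rowSum/colSum_scaleZero_weighted_le_numeral`, …WeightedSizesNumeral) supplies the
former with `a = 10⁹⁵` under the engine's binders.  Hence (**`twoLeg_offDiag_moment_pow_sum_tail3_frameZero_le_numeral`**): for `μ ∈ klWindowC`, `0 < U`,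
`klBetaMin ≤ β`, `klEngL₃ β U ≤ L`, `klEngM₃ β U L ≤ M`, `k ≤ 4` and `16e⁹·46·10⁹⁵·|U| ≤ 1/2`,
`Σ_{p₁}[x⃗₁ ≠ x⃗₀](1+|Δx̃₀|+|Δx̃₁|)ᵏ‖kernel₂ T₃((p₀,σ,+),(p₁,σ,−))‖ ≤ 2ᵏ·2¹³·e²⁷·46³·10¹⁹⁰·|U|³·β/(4M)` — the assembly books `|U|³ ≤ U²·klTailBookU` (AMENDMENT 22′, exponent 300).

Proofs only; no definitions; nothing here asserts (C), any stub of 20437, K3 or superconductivity.  References: BGM 2006 (2.13)–(2.14), (2.77)–(2.80)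
[cite: BenfattoGiulianiMastropietro2006]; Pedra–Salmhofer 2008 Thm 2.4 [cite: PedraSalmhofer2008].
-/

noncomputable section

namespace Summit.HubbardSuperconductivity.HubbardSuperconductivity.Theorems.EngineV8

set_option linter.dupNamespace false -- summit = problem name (single-conjunct summit), D-0017

open Real Finset Literature.MathematicalPhysics.QuantumLattice Literature.Probability.LatticeModels
open Literature.Probability.LatticeModels.BattleFederbush GrassmannAlgebra
open Summit.HubbardSuperconductivity.HubbardSuperconductivity.Theorems.KLRegimeSplit
open Summit.HubbardSuperconductivity.HubbardSuperconductivity.Theorems.DispersionFlow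

variable {L : ℕ} [NeZero L] {M : ℕ} [NeZero M]

/-- **THE OFF-SITE MOMENT ROWS OF THE TAIL WITH THE NUMERAL SIZE `a = 10⁹⁵`** (`λ = 1`, `k ≤ 4`; engine binders; smallness `16e⁹·46·10⁹⁵·|U| ≤ 1/2`):
`Σ_{p₁}[x⃗₁ ≠ x⃗₀](1+|Δx̃₀|+|Δx̃₁|)ᵏ‖kernel₂ T₃‖ ≤ 2ᵏ·(2¹³e²⁷46³·(10⁹⁵)²)·|U|³·β/(2(2M))`. -/
theorem twoLeg_offDiag_moment_pow_sum_tail3_frameZero_le_numeral {μ : ℝ} (hμ : μ ∈ klWindowC) {U : ℝ} (hU : 0 < U) {β : ℝ}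
    (hβ : klBetaMin ≤ β) (hL : klEngL₃ β U ≤ L) (hM : klEngM₃ β U L ≤ M) {k : ℕ} (hk : k ≤ 4)
    (hsmall : 16 * Real.exp 1 ^ 9 * 46 * (10 : ℝ) ^ 95 * |U| ≤ 1 / 2) (σ : Fin 2) (p₀ : GridPoint L (2 * (2 * M))) :
    ∑ p₁ : GridPoint L (2 * (2 * M)), (if p₁.2 - p₀.2 = 0 then (0 : ℝ) else
        (1 + (((p₁.2 - p₀.2) 0).valMinAbs.natAbs : ℝ) + (((p₁.2 - p₀.2) 1).valMinAbs.natAbs : ℝ)) ^ k) *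
      ‖kernel ℂ (effAction ℂ ((hubbardGridSub L M β (2 * (2 * M))).transpose * hubbardCovAboveCT L M β μ 0 0 klE0 *
              hubbardGridSub L M β (2 * (2 * M))) (hubbardGridInteraction L (2 * (2 * M)) β U) -
          gaussConv ℂ ((hubbardGridSub L M β (2 * (2 * M))).transpose * hubbardCovAboveCT L M β μ 0 0 klE0 *
              hubbardGridSub L M β (2 * (2 * M))) (hubbardGridInteraction L (2 * (2 * M)) β U) +
          (2 : ℂ)⁻¹ • (gaussConv ℂ ((hubbardGridSub L M β (2 * (2 * M))).transpose * hubbardCovAboveCT L M β μ 0 0 klE0 *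
                hubbardGridSub L M β (2 * (2 * M)))
              (hubbardGridInteraction L (2 * (2 * M)) β U * hubbardGridInteraction L (2 * (2 * M)) β U) -
            gaussConv ℂ ((hubbardGridSub L M β (2 * (2 * M))).transpose * hubbardCovAboveCT L M β μ 0 0 klE0 *
                hubbardGridSub L M β (2 * (2 * M))) (hubbardGridInteraction L (2 * (2 * M)) β U) *
            gaussConv ℂ ((hubbardGridSub L M β (2 * (2 * M))).transpose * hubbardCovAboveCT L M β μ 0 0 klE0 *
                hubbardGridSub L M β (2 * (2 * M))) (hubbardGridInteraction L (2 * (2 * M)) β U)))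
        2 (fun i => ((![p₀, p₁] i, σ), i))‖ ≤
      (2 : ℝ) ^ k * ((2 : ℝ) ^ 13 * Real.exp 1 ^ 27 * (46 : ℝ) ^ 3 * ((10 : ℝ) ^ 95) ^ 2 * |U| ^ 3 * (β / ((2 * (2 * M) : ℕ) : ℝ))) := by
  have hrow := fun X => rowSum_scaleZero_weighted_le_numeral (L := L) (M := M) hμ hβ hL hM hk zero_le_one le_rfl X
  have hcol := fun Y => colSum_scaleZero_weighted_le_numeral (L := L) (M := M) hμ hβ hL hM hk zero_le_one le_rfl Y
  have h := twoLeg_offDiag_moment_pow_sum_tail3_frameZero_le (L := L) (M := M) hμ hU hβ hL k one_pos le_rfl (by positivity : (0 : ℝ) < 10 ^ 95)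
    hrow hcol hsmall σ p₀
  rw [div_one] at h
  exact h


/-! ## §2 Booked form: `|U|³ ≤ U²·Ub` against any coupling binder `U ≤ Ub ≤ 10⁻¹⁰³` (e.g. `Ub := klTailBookU`, AMENDMENT 22′) -/

/-- The smallness `16e⁹·46·10⁹⁵·|U| ≤ 1/2` from `0 < U ≤ Ub ≤ 10⁻¹⁰³`. -/
theorem hsmall_numeral_of_le {U Ub : ℝ} (hU : 0 < U) (hUb : U ≤ Ub) (hUb' : Ub ≤ 1 / (10 : ℝ) ^ 103) :
    16 * Real.exp 1 ^ 9 * 46 * (10 : ℝ) ^ 95 * |U| ≤ 1 / 2 := by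
  have he : Real.exp 1 < 2.7182818286 := Real.exp_one_lt_d9
  have he9 : Real.exp 1 ^ 9 ≤ 3 ^ 9 := pow_le_pow_left₀ (Real.exp_pos 1).le (by linarith) 9
  rw [abs_of_pos hU]
  have hU' : U ≤ 1 / (10 : ℝ) ^ 103 := hUb.trans hUb'
  calc 16 * Real.exp 1 ^ 9 * 46 * (10 : ℝ) ^ 95 * U ≤ 16 * 3 ^ 9 * 46 * (10 : ℝ) ^ 95 * (1 / (10 : ℝ) ^ 103) := by
        have h0 : 0 ≤ 16 * Real.exp 1 ^ 9 * 46 * (10 : ℝ) ^ 95 := by positivity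
        calc _ ≤ 16 * Real.exp 1 ^ 9 * 46 * (10 : ℝ) ^ 95 * (1 / (10 : ℝ) ^ 103) := mul_le_mul_of_nonneg_left hU' h0
          _ ≤ _ := by gcongr
    _ ≤ 1 / 2 := by norm_num

/-- **THE TAIL'S OFF-SITE MOMENT ROWS, BOOKED AGAINST A COUPLING BINDER** `0 < U ≤ Ub ≤ 10⁻¹⁰³` (the assembly takes `Ub := klTailBookU = 10⁻³⁰⁰`): for every `k ≤ 4`,
`Σ_{p₁}[x⃗₁ ≠ x⃗₀](1+|Δx̃₀|+|Δx̃₁|)ᵏ‖kernel₂ T₃‖ ≤ (2ᵏ·2¹³e²⁷46³·10¹⁹⁰·Ub)·U²·β/(2(2M))` — the `tb k·U²·β/4M` shape of `twoLegRead_frameZero_of_sunsetData`'s `hToff`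
with `tb k = 2ᵏ·2¹³e²⁷46³·10¹⁹⁰·Ub`. -/
theorem twoLeg_offDiag_moment_pow_sum_tail3_frameZero_le_booked_numeral {μ : ℝ} (hμ : μ ∈ klWindowC) {U : ℝ} (hU : 0 < U) {Ub : ℝ} (hUb : U ≤ Ub)
    (hUb' : Ub ≤ 1 / (10 : ℝ) ^ 103) {β : ℝ} (hβ : klBetaMin ≤ β) (hL : klEngL₃ β U ≤ L) (hM : klEngM₃ β U L ≤ M) {k : ℕ} (hk : k ≤ 4)
    (σ : Fin 2) (p₀ : GridPoint L (2 * (2 * M))) :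
    ∑ p₁ : GridPoint L (2 * (2 * M)), (if p₁.2 - p₀.2 = 0 then (0 : ℝ) else
        (1 + (((p₁.2 - p₀.2) 0).valMinAbs.natAbs : ℝ) + (((p₁.2 - p₀.2) 1).valMinAbs.natAbs : ℝ)) ^ k) *
      ‖kernel ℂ (effAction ℂ ((hubbardGridSub L M β (2 * (2 * M))).transpose * hubbardCovAboveCT L M β μ 0 0 klE0 *
              hubbardGridSub L M β (2 * (2 * M))) (hubbardGridInteraction L (2 * (2 * M)) β U) -
          gaussConv ℂ ((hubbardGridSub L M β (2 * (2 * M))).transpose * hubbardCovAboveCT L M β μ 0 0 klE0 *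
              hubbardGridSub L M β (2 * (2 * M))) (hubbardGridInteraction L (2 * (2 * M)) β U) +
          (2 : ℂ)⁻¹ • (gaussConv ℂ ((hubbardGridSub L M β (2 * (2 * M))).transpose * hubbardCovAboveCT L M β μ 0 0 klE0 *
                hubbardGridSub L M β (2 * (2 * M)))
              (hubbardGridInteraction L (2 * (2 * M)) β U * hubbardGridInteraction L (2 * (2 * M)) β U) -
            gaussConv ℂ ((hubbardGridSub L M β (2 * (2 * M))).transpose * hubbardCovAboveCT L M β μ 0 0 klE0 *
                hubbardGridSub L M β (2 * (2 * M))) (hubbardGridInteraction L (2 * (2 * M)) β U) *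
            gaussConv ℂ ((hubbardGridSub L M β (2 * (2 * M))).transpose * hubbardCovAboveCT L M β μ 0 0 klE0 *
                hubbardGridSub L M β (2 * (2 * M))) (hubbardGridInteraction L (2 * (2 * M)) β U)))
        2 (fun i => ((![p₀, p₁] i, σ), i))‖ ≤
      ((2 : ℝ) ^ k * ((2 : ℝ) ^ 13 * Real.exp 1 ^ 27 * (46 : ℝ) ^ 3 * ((10 : ℝ) ^ 95) ^ 2) * Ub) * U ^ 2 * (β / ((2 * (2 * M) : ℕ) : ℝ)) := by
  have hβ0 : 0 < β := lt_of_lt_of_le (by norm_num [klBetaMin]) hβ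
  have h := twoLeg_offDiag_moment_pow_sum_tail3_frameZero_le_numeral (L := L) (M := M) hμ hU hβ hL hM hk (hsmall_numeral_of_le hU hUb hUb') σ p₀
  refine h.trans ?_
  have hU3 : |U| ^ 3 ≤ U ^ 2 * Ub := by
    rw [abs_of_pos hU, pow_succ]
    exact mul_le_mul_of_nonneg_left hUb (by positivity)
  have hC : 0 ≤ (2 : ℝ) ^ k * ((2 : ℝ) ^ 13 * Real.exp 1 ^ 27 * (46 : ℝ) ^ 3 * ((10 : ℝ) ^ 95) ^ 2) * (β / ((2 * (2 * M) : ℕ) : ℝ)) := by positivity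
  calc (2 : ℝ) ^ k * ((2 : ℝ) ^ 13 * Real.exp 1 ^ 27 * (46 : ℝ) ^ 3 * ((10 : ℝ) ^ 95) ^ 2 * |U| ^ 3 * (β / ((2 * (2 * M) : ℕ) : ℝ)))
      = (2 : ℝ) ^ k * ((2 : ℝ) ^ 13 * Real.exp 1 ^ 27 * (46 : ℝ) ^ 3 * ((10 : ℝ) ^ 95) ^ 2) * (β / ((2 * (2 * M) : ℕ) : ℝ)) * |U| ^ 3 := by ring
    _ ≤ (2 : ℝ) ^ k * ((2 : ℝ) ^ 13 * Real.exp 1 ^ 27 * (46 : ℝ) ^ 3 * ((10 : ℝ) ^ 95) ^ 2) * (β / ((2 * (2 * M) : ℕ) : ℝ)) * (U ^ 2 * Ub) :=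
        mul_le_mul_of_nonneg_left hU3 hC
    _ = _ := by ring


/-! ## §3 The ω-weighted (on-site / plain) tail row with the numeral size, booked the same way -/

/-- **THE ω-WEIGHTED TAIL ROW WITH `a = 10⁹⁵`, BOOKED AGAINST `0 < U ≤ Ub ≤ 10⁻¹⁰³`**: for any pair weight `0 ≤ ω ≤ 1` (the on-site indicator of `hTon`, or `ω ≡ 1`),
`Σ_{p₁} ω(p₀,p₁)‖kernel₂ T₃‖ ≤ (2¹³e²⁷46³·10¹⁹⁰·Ub²)·|U|·β/(2(2M))` — the `tv·|U|·β/4M` shape of `twoLegRead_frameZero_of_sunsetData`'s `hTon` (tail share), from the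
`k = 0` numeral rows (weight `(1+s)⁰ ≡ 1`) and p1 g18's `twoLeg_wsum_tail3_frameZero_le_of_le_one`. -/
theorem twoLeg_wsum_tail3_frameZero_le_booked_numeral {μ : ℝ} (hμ : μ ∈ klWindowC) {U : ℝ} (hU : 0 < U) {Ub : ℝ} (hUb : U ≤ Ub)
    (hUb' : Ub ≤ 1 / (10 : ℝ) ^ 103) {β : ℝ} (hβ : klBetaMin ≤ β) (hL : klEngL₃ β U ≤ L) (hM : klEngM₃ β U L ≤ M)
    (ω : GridPoint L (2 * (2 * M)) → GridPoint L (2 * (2 * M)) → ℝ) (hω0 : ∀ p q, 0 ≤ ω p q) (hω1 : ∀ p q, ω p q ≤ 1)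
    (σ : Fin 2) (p₀ : GridPoint L (2 * (2 * M))) :
    ∑ p₁ : GridPoint L (2 * (2 * M)), ω p₀ p₁ *
      ‖kernel ℂ (effAction ℂ ((hubbardGridSub L M β (2 * (2 * M))).transpose * hubbardCovAboveCT L M β μ 0 0 klE0 *
              hubbardGridSub L M β (2 * (2 * M))) (hubbardGridInteraction L (2 * (2 * M)) β U) -
          gaussConv ℂ ((hubbardGridSub L M β (2 * (2 * M))).transpose * hubbardCovAboveCT L M β μ 0 0 klE0 *
              hubbardGridSub L M β (2 * (2 * M))) (hubbardGridInteraction L (2 * (2 * M)) β U) +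
          (2 : ℂ)⁻¹ • (gaussConv ℂ ((hubbardGridSub L M β (2 * (2 * M))).transpose * hubbardCovAboveCT L M β μ 0 0 klE0 *
                hubbardGridSub L M β (2 * (2 * M)))
              (hubbardGridInteraction L (2 * (2 * M)) β U * hubbardGridInteraction L (2 * (2 * M)) β U) -
            gaussConv ℂ ((hubbardGridSub L M β (2 * (2 * M))).transpose * hubbardCovAboveCT L M β μ 0 0 klE0 *
                hubbardGridSub L M β (2 * (2 * M))) (hubbardGridInteraction L (2 * (2 * M)) β U) *
            gaussConv ℂ ((hubbardGridSub L M β (2 * (2 * M))).transpose * hubbardCovAboveCT L M β μ 0 0 klE0 *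
                hubbardGridSub L M β (2 * (2 * M))) (hubbardGridInteraction L (2 * (2 * M)) β U)))
        2 (fun i => ((![p₀, p₁] i, σ), i))‖ ≤
      ((2 : ℝ) ^ 13 * Real.exp 1 ^ 27 * (46 : ℝ) ^ 3 * ((10 : ℝ) ^ 95) ^ 2 * Ub ^ 2) * |U| * (β / ((2 * (2 * M) : ℕ) : ℝ)) := by
  haveI : NeZero (2 * (2 * M)) := ⟨by have := NeZero.ne M; omega⟩
  have hβ0 : 0 < β := lt_of_lt_of_le (by norm_num [klBetaMin]) hβ
  -- the unweighted sizes from the `k = 0` numeral rows (`(1 + 1·s)⁰ ≡ 1`)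
  have hw : ∀ S : Finset (ZMod (2 * (2 * M)) × TorusSite 2 L),
      diamWeight (fun s : ℝ => (1 + (1 : ℝ) * s) ^ 0) (gridLabelDist L (2 * (2 * M)) β) S = 1 := fun S => by simp [diamWeight]
  have hrow : ∀ X, ∑ Y, ‖((hubbardGridSub L M β (2 * (2 * M))).transpose * hubbardCovAboveCT L M β μ 0 0 klE0 *
      hubbardGridSub L M β (2 * (2 * M))) X Y‖ ≤ (10 : ℝ) ^ 95 * ((2 * (2 * M) : ℕ) : ℝ) / β := fun X => by
    have h := rowSum_scaleZero_weighted_le_numeral (L := L) (M := M) hμ hβ hL hM (k := 0) (by norm_num) zero_le_one le_rfl X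
    simpa only [hw, mul_one] using h
  have hcol : ∀ Y, ∑ X, ‖((hubbardGridSub L M β (2 * (2 * M))).transpose * hubbardCovAboveCT L M β μ 0 0 klE0 *
      hubbardGridSub L M β (2 * (2 * M))) X Y‖ ≤ (10 : ℝ) ^ 95 * ((2 * (2 * M) : ℕ) : ℝ) / β := fun Y => by
    have h := colSum_scaleZero_weighted_le_numeral (L := L) (M := M) hμ hβ hL hM (k := 0) (by norm_num) zero_le_one le_rfl Y
    simpa only [hw, mul_one] using h
  have h := twoLeg_wsum_tail3_frameZero_le_of_le_one (L := L) (M := M) hμ hU hβ hL (by positivity : (0 : ℝ) < 10 ^ 95) hrow hcol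
    (hsmall_numeral_of_le hU hUb hUb') ω hω0 hω1 σ p₀
  refine h.trans ?_
  have hUb0 : 0 ≤ Ub := hU.le.trans hUb
  have hU3 : |U| ^ 3 ≤ Ub ^ 2 * |U| := by
    rw [abs_of_pos hU]
    have h2 : U ^ 2 ≤ Ub ^ 2 := pow_le_pow_left₀ hU.le hUb 2
    calc U ^ 3 = U ^ 2 * U := by ring
      _ ≤ Ub ^ 2 * U := mul_le_mul_of_nonneg_right h2 hU.le
  have hC : 0 ≤ (2 : ℝ) ^ 13 * Real.exp 1 ^ 27 * (46 : ℝ) ^ 3 * ((10 : ℝ) ^ 95) ^ 2 * (β / ((2 * (2 * M) : ℕ) : ℝ)) := by positivity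
  calc (2 : ℝ) ^ 13 * Real.exp 1 ^ 27 * (46 : ℝ) ^ 3 * ((10 : ℝ) ^ 95) ^ 2 * |U| ^ 3 * (β / ((2 * (2 * M) : ℕ) : ℝ))
      = (2 : ℝ) ^ 13 * Real.exp 1 ^ 27 * (46 : ℝ) ^ 3 * ((10 : ℝ) ^ 95) ^ 2 * (β / ((2 * (2 * M) : ℕ) : ℝ)) * |U| ^ 3 := by ring
    _ ≤ (2 : ℝ) ^ 13 * Real.exp 1 ^ 27 * (46 : ℝ) ^ 3 * ((10 : ℝ) ^ 95) ^ 2 * (β / ((2 * (2 * M) : ℕ) : ℝ)) * (Ub ^ 2 * |U|) :=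
        mul_le_mul_of_nonneg_left hU3 hC
    _ = _ := by ring

end Summit.HubbardSuperconductivity.HubbardSuperconductivity.Theorems.EngineV8

end
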